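import Mathlib.AlgebraicGeometry.ZariskisMainTheorem
import Literature.AlgebraicGeometry.Motives.BijectiveMorphismIso
import Literature.AlgebraicGeometry.Motives.PullbackOver
import HarnessLib

/-!
# A bijective morphism of irreducible varieties onto a normal variety is an isomorphism
# (characteristic zero) — the general form, by Zariski's Main Theorem

`K` algebraically closed, `f : X ⟶ Y` a `K`-morphism, `X` locally of finite type over `K`.
* `universallyInjective_of_injective` (any characteristic): `f` separated and INJECTIVE on
  `K`-points ⇒ `f` universally injective (its diagonal, a closed immersion, contains every closed
  point of `X ×_Y X`: a pair of `K`-points with the same image), hence quasi-finite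
  (`locallyQuasiFinite_of_injective`); a PROPER `f` bijective on `K`-points onto an irreducible
  `Y` has irreducible source (`irreducibleSpace_of_bijective_of_isProper`).
* `isOpenImmersion_of_injective` (characteristic `0`): `X`, `Y` integral, `f` separated,
  quasi-compact, dominant, injective on `K`-points, `Y` NORMAL ⇒ `f` is an OPEN IMMERSION:
  `K(Y) → K(X)` is purely inseparable (Stacks 01S4) hence trivial
  (`isIso_stalkMap_genericPoint_of_injective`, Springer 5.1.6 (iii)); by Zariski's Main Theorem
  in Grothendieck's form (Mathlib `Mathlib.AlgebraicGeometry.ZariskisMainTheorem`: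
  `f.toNormalization : X ⟶ X′` is an open immersion for `f` quasi-finite separated of finite
  type) it remains that the integral birational `X′ → Y` onto the normal `Y` is an isomorphism
  (`isIso_fromNormalization_of_injective`, via the tree's
  `Resolution.isIso_morphismRestrict_of_isIntegralHom_of_isIso_stalkMap`) — Görtz–Wedhorn 12.88.
* `isIso_of_bijective_of_isIntegral` (characteristic `0`) — **Springer, *Linear Algebraic
  Groups*, Thm. 5.2.8 / Borel AG.18.2 in their printed generality**: a morphism of irreducible
  varieties, bijective on `K`-points, onto a normal variety is an isomorphism — NO properness
  (discharges the `TODO(general form)` of `isIso_of_bijective_of_isIntegrallyClosed`).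
* `isIso_of_bijective_of_isProper` — the RELATIVE form: `f` proper, `X` reduced, `Y` integral
  normal, `f` bijective on `K`-points ⇒ isomorphism (the recogniser for proper comparison maps
  between NON-proper varieties, e.g. level transitions of Shimura towers modulo finite groups).
Counterexamples: Frobenius of `𝔸¹` (char. `p`); normalisation of the cusp (`Y` not normal);
`𝔸¹ ∖ {0} ⊔ {pt} → 𝔸¹` (`X` reducible, `f` not proper); `Spec K[ε]/(ε²) → Spec K` (non-reduced).

## References
* T. A. Springer, *Linear Algebraic Groups*, 2nd ed. (1998), Thm. 5.2.8 (p. 85),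
  Thm. 5.1.6 (iii) (p. 82). [Springer1998]
* A. Borel, *Linear Algebraic Groups*, 2nd ed. (1991), AG.18.2; quoted in G. A. Margulis,
  *Discrete Subgroups of Semisimple Lie Groups* (1991), Ch. I (0.9). [Margulis1991]
* U. Görtz, T. Wedhorn, *Algebraic Geometry I* (2020), Cor. 12.88, Prop. 3.35. [GortzWedhorn2020]
* The Stacks Project, Tag 01S4, Tag 03GW. [StacksProject]
* D. Mumford, *The Red Book*, III §9, Original form (I). [MumfordRedBook1999]
-/

noncomputable section

universe u

open CategoryTheory CategoryTheory.Limits AlgebraicGeometry TopologicalSpace Topology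

namespace Literature.AlgebraicGeometry.Motives

/-! ### `K`-points exhaust a scheme locally of finite type over `K = K̄` -/

section KPoints

variable {K : Type u} [Field K] [IsAlgClosed K] {X Y : SchemeOver K}

/-- **A closed subset containing the points of all `K`-points is everything** (`X` locally of
finite type over the algebraically closed `K`): closed points are the points of `K`-points
(Nullstellensatz) and are dense (Jacobson). [cite: GortzWedhorn2020, Prop. 3.35] -/
theorem eq_univ_of_isClosed_of_forall_pt_mem [LocallyOfFiniteType X.hom] {Z : Set X.left}
    (hZ : IsClosed Z) (h : ∀ P : AlgPoints X K, P.pt ∈ Z) : Z = Set.univ := by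
  haveI : JacobsonSpace ↥X.left := LocallyOfFiniteType.jacobsonSpace X.hom
  have hsub : closedPoints ↥X.left ⊆ Z := fun x hx ↦ by
    obtain ⟨z, hz⟩ :=
      AlgPoints.exists_pt_eq_of_isClosed_singleton (X := X) (mem_closedPoints_iff.mp hx)
    exact hz ▸ h z
  apply Set.eq_univ_of_univ_subset
  rw [← closure_closedPoints (X := ↥X.left)]
  exact closure_minimal hsub hZ

/-- An open subset containing the points of all `K`-points is everything (private copy of
`eq_univ_of_isOpen_of_forall_pt_mem` of `Motives/CurveLinearSystemOpens`, not imported to keep the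
curve theory out of the imports). [cite: GortzWedhorn2020, Prop. 3.35] -/
private theorem eq_univ_of_isOpen_of_forall_pt_mem' [LocallyOfFiniteType X.hom] {U : Set X.left}
    (hU : IsOpen U) (h : ∀ P : AlgPoints X K, P.pt ∈ U) : U = Set.univ := by
  haveI : JacobsonSpace ↥X.left := LocallyOfFiniteType.jacobsonSpace X.hom
  by_contra hne
  obtain ⟨x, hxU, hxc⟩ := nonempty_inter_closedPoints (X := ↥X.left) (Set.nonempty_compl.mpr hne)
    hU.isClosed_compl.isLocallyClosed
  obtain ⟨z, hz⟩ :=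
    AlgPoints.exists_pt_eq_of_isClosed_singleton (X := X) (mem_closedPoints_iff.mp hxc)
  exact hxU (hz ▸ h z)

variable (f : X ⟶ Y)

omit [IsAlgClosed K] in
/-- A `K`-morphism out of a `K`-scheme locally of finite type is locally of finite type.
[cite: GortzWedhorn2020, Prop. 3.35] -/
theorem locallyOfFiniteType_left [LocallyOfFiniteType X.hom] : LocallyOfFiniteType f.left := by
  have : LocallyOfFiniteType (f.left ≫ Y.hom) := by rw [Over.w f]; infer_instance
  exact locallyOfFiniteType_of_comp f.left Y.hom

/-- **Surjective on `K`-points ⇒ dominant** (`Y` locally of finite type over `K = K̄`): the image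
contains every closed point of `Y`, and these are dense. [cite: GortzWedhorn2020, Prop. 3.35] -/
theorem isDominant_of_surjective_map [LocallyOfFiniteType Y.hom]
    (h : Function.Surjective (AlgPoints.map (L := K) f)) : IsDominant f.left := by
  haveI : JacobsonSpace ↥Y.left := LocallyOfFiniteType.jacobsonSpace Y.hom
  have hsub : closedPoints ↥Y.left ⊆ Set.range f.left := fun y hy ↦ by
    obtain ⟨z, hz⟩ :=
      AlgPoints.exists_pt_eq_of_isClosed_singleton (X := Y) (mem_closedPoints_iff.mp hy)
    obtain ⟨x, rfl⟩ := h z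
    exact ⟨x.pt, by rw [← hz, AlgPoints.pt_map]⟩
  refine ⟨fun y ↦ ?_⟩
  have hy : y ∈ closure (closedPoints ↥Y.left) := by
    rw [closure_closedPoints (X := ↥Y.left)]; trivial
  exact closure_mono hsub hy

/-- **Surjective on `K`-points with open image ⇒ surjective** (`Y` locally of finite type over
`K = K̄`). [cite: GortzWedhorn2020, Prop. 3.35] -/
theorem surjective_of_isOpen_range_of_surjective_map [LocallyOfFiniteType Y.hom]
    (hopen : IsOpen (Set.range f.left)) (h : Function.Surjective (AlgPoints.map (L := K) f)) :
    Surjective f.left := by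
  refine ⟨fun y ↦ ?_⟩
  have huniv := eq_univ_of_isOpen_of_forall_pt_mem' (X := Y) hopen fun Q ↦ by
    obtain ⟨P, rfl⟩ := h Q
    exact ⟨P.pt, (AlgPoints.pt_map f P).symm⟩
  have hy : y ∈ Set.range f.left := by rw [huniv]; trivial
  exact hy

/-! ### Injective on `K`-points ⇒ universally injective ⇒ quasi-finite (any characteristic) -/

/-- **The diagonal of a separated `f` injective on `K`-points is surjective**: the diagonal is a
closed immersion, and its image contains every closed point of `X ×_Y X`, for such a point is a
`K`-point `(P, Q)` with `f P = f Q`, i.e. `P = Q`. [cite: StacksProject, Tag 01S4] -/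
theorem surjective_diagonal_of_injective [LocallyOfFiniteType X.hom] [IsSeparated f.left]
    (hinj : Function.Injective (AlgPoints.map (L := K) f)) :
    Surjective (pullback.diagonal f.left) := by
  haveI := locallyOfFiniteType_left f
  haveI : LocallyOfFiniteType (pullbackOver f f).hom := by
    change LocallyOfFiniteType (pullback.fst f.left f.left ≫ X.hom)
    infer_instance
  have hcl : IsClosed (Set.range (pullback.diagonal f.left)) :=
    (pullback.diagonal f.left).isClosedEmbedding.isClosed_range
  have huniv := eq_univ_of_isClosed_of_forall_pt_mem (X := pullbackOver f f) hcl fun R ↦ by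
    -- `R = (P, Q)` with `f P = f Q`, so `P = Q` and `R = Δ(P)`
    have hPQ : AlgPoints.map (pullbackOver.fst f f) R = AlgPoints.map (pullbackOver.snd f f) R :=
      hinj (pullbackOver.pointsEquiv f f K R).2
    have hR : R = AlgPoints.map (pullbackOver.lift (f := f) (g := f) (𝟙 X) (𝟙 X) rfl)
        (AlgPoints.map (pullbackOver.fst f f) R) := by
      refine pullbackOver.hom_ext ?_ ?_
      · rw [AlgPoints.map_apply, AlgPoints.map_apply, Category.assoc, pullbackOver.lift_fst,
          Category.comp_id]
      · rw [AlgPoints.map_apply, AlgPoints.map_apply, Category.assoc, pullbackOver.lift_snd,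
          Category.comp_id, ← AlgPoints.map_apply, ← AlgPoints.map_apply, hPQ]
    refine ⟨(AlgPoints.map (pullbackOver.fst f f) R).pt, ?_⟩
    conv_rhs => rw [hR]
    rfl
  refine ⟨fun w ↦ ?_⟩
  have hw : w ∈ Set.range (pullback.diagonal f.left) := by rw [huniv]; trivial
  exact hw

/-- **Injective on `K`-points ⇒ universally injective** (`f` separated, `X` locally of finite type
over `K = K̄`; Stacks 01S4: universally injective ⟺ surjective diagonal).
[cite: StacksProject, Tag 01S4] -/
theorem universallyInjective_of_injective [LocallyOfFiniteType X.hom] [IsSeparated f.left]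
    (hinj : Function.Injective (AlgPoints.map (L := K) f)) : UniversallyInjective f.left :=
  ((tfae_universallyInjective f.left).out 0 3).mpr (surjective_diagonal_of_injective f hinj)

/-- **Injective on `K`-points ⇒ quasi-finite** (`f` separated, `X` locally of finite type over
`K = K̄`): universally injective + locally of finite type. [cite: StacksProject, Tag 01S4] -/
theorem locallyQuasiFinite_of_injective [LocallyOfFiniteType X.hom] [IsSeparated f.left]
    (hinj : Function.Injective (AlgPoints.map (L := K) f)) : LocallyQuasiFinite f.left :=
  haveI := locallyOfFiniteType_left f
  haveI := universallyInjective_of_injective f hinj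
  inferInstance

/-! ### Proper morphisms injective on `K`-points: irreducible source (any characteristic) -/

/-- For `f` proper and injective on `K`-points, **a closed subset of `X` mapping onto `Y` is all of
`X`**: the fibre through any `K`-point `P` meets it in a closed point, which is `P` by injectivity.
[cite: Springer1998, Thm. 5.2.8 (p. 85)] -/
theorem eq_univ_of_isClosed_of_image_eq_univ [LocallyOfFiniteType X.hom] [LocallyOfFiniteType Y.hom]
    (hinj : Function.Injective (AlgPoints.map (L := K) f)) {C : Set X.left} (hC : IsClosed C)
    (hCY : f.left '' C = Set.univ) : C = Set.univ := by
  haveI : JacobsonSpace ↥X.left := LocallyOfFiniteType.jacobsonSpace X.hom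
  refine eq_univ_of_isClosed_of_forall_pt_mem hC fun P ↦ ?_
  -- a closed point of `X` in `C ∩ f⁻¹(f P)`
  have hfib : IsClosed (C ∩ f.left ⁻¹' {(AlgPoints.map f P).pt}) :=
    hC.inter ((AlgPoints.isClosed_singleton_pt _).preimage f.left.continuous)
  have hne : (C ∩ f.left ⁻¹' {(AlgPoints.map f P).pt}).Nonempty := by
    obtain ⟨x, hxC, hx⟩ : (AlgPoints.map f P).pt ∈ f.left '' C := hCY ▸ Set.mem_univ _
    exact ⟨x, hxC, hx⟩
  obtain ⟨x, ⟨hxC, hx⟩, hxcl⟩ := nonempty_inter_closedPoints hne hfib.isLocallyClosed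
  obtain ⟨Q, hQ⟩ :=
    AlgPoints.exists_pt_eq_of_isClosed_singleton (X := X) (mem_closedPoints_iff.mp hxcl)
  have hQP : AlgPoints.map f Q = AlgPoints.map f P :=
    AlgPoints.eq_of_pt_eq (by rw [AlgPoints.pt_map, hQ]; exact hx)
  rw [← hinj hQP, hQ]
  exact hxC

/-- **A proper morphism bijective on `K`-points onto an irreducible `Y` has irreducible source**:
`f` is onto (closed image containing the closed points); of two closed subsets covering `X` one maps
onto `Y`, hence is everything (`eq_univ_of_isClosed_of_image_eq_univ`).
[cite: Springer1998, Thm. 5.2.8 (p. 85)] -/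
theorem irreducibleSpace_of_bijective_of_isProper [IsIntegral Y.left] [LocallyOfFiniteType X.hom]
    [LocallyOfFiniteType Y.hom] [IsProper f.left]
    (hf : Function.Bijective (AlgPoints.map (L := K) f)) : IrreducibleSpace ↥X.left := by
  haveI : JacobsonSpace ↥Y.left := LocallyOfFiniteType.jacobsonSpace Y.hom
  have hrange : Set.range f.left = Set.univ :=
    eq_univ_of_isClosed_of_forall_pt_mem (X := Y) f.left.isClosedMap.isClosed_range fun Q ↦ by
      obtain ⟨P, rfl⟩ := hf.2 Q
      exact ⟨P.pt, (AlgPoints.pt_map f P).symm⟩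
  -- non-empty: a closed point of `Y` is hit by a `K`-point of `X`
  obtain ⟨y, -, hy⟩ := nonempty_inter_closedPoints (Set.univ_nonempty (α := ↥Y.left))
    isClosed_univ.isLocallyClosed
  obtain ⟨Q, -⟩ :=
    AlgPoints.exists_pt_eq_of_isClosed_singleton (X := Y) (mem_closedPoints_iff.mp hy)
  obtain ⟨P, -⟩ := hf.2 Q
  have hpre : IsPreirreducible (Set.univ : Set X.left) := by
    refine isPreirreducible_iff_isClosed_union_isClosed.mpr fun Z₁ Z₂ hZ₁ hZ₂ hcov ↦ ?_
    have hY : (Set.univ : Set Y.left) ⊆ f.left '' Z₁ ∪ f.left '' Z₂ := by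
      rintro y -
      obtain ⟨x, rfl⟩ : y ∈ Set.range f.left := hrange ▸ Set.mem_univ y
      rcases hcov (Set.mem_univ x) with h | h
      · exact Or.inl ⟨x, h, rfl⟩
      · exact Or.inr ⟨x, h, rfl⟩
    rcases isPreirreducible_iff_isClosed_union_isClosed.mp
        (IrreducibleSpace.isIrreducible_univ (X := ↥Y.left)).isPreirreducible _ _
        (f.left.isClosedMap _ hZ₁) (f.left.isClosedMap _ hZ₂) hY with h | h
    · exact Or.inl (eq_univ_of_isClosed_of_image_eq_univ f hf.1 hZ₁
        (Set.eq_univ_of_univ_subset h)).symm.subset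
    · exact Or.inr (eq_univ_of_isClosed_of_image_eq_univ f hf.1 hZ₂
        (Set.eq_univ_of_univ_subset h)).symm.subset
  exact @IrreducibleSpace.mk _ _ ⟨hpre⟩ ⟨P.pt⟩

end KPoints

/-! ### Characteristic zero: injective dominant ⇒ birational ⇒ open immersion; bijective ⇒ iso -/

section CharZero

variable {K : Type u} [Field K] [IsAlgClosed K] [CharZero K] {X Y : SchemeOver K} (f : X ⟶ Y)

/-- **In characteristic `0` an injective dominant morphism of irreducible varieties is
birational**: the stalk map of `f` at the generic point — the extension of function fields
`K(Y) → K(X)` — is an isomorphism, because `f` is universally injective, so the extension is purely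
inseparable (Stacks 01S4), hence trivial in characteristic zero.
[cite: Springer1998, Thm. 5.1.6 (iii) (p. 82)] [cite: StacksProject, Tag 01S4] -/
theorem isIso_stalkMap_genericPoint_of_injective [IsIntegral X.left] [IsIntegral Y.left]
    [LocallyOfFiniteType X.hom] [IsSeparated f.left] [IsDominant f.left]
    (hinj : Function.Injective (AlgPoints.map (L := K) f)) :
    IsIso (f.left.stalkMap (genericPoint ↥X.left)) := by
  set ξ := genericPoint ↥X.left with hξ
  have hUI : UniversallyInjective f.left := universallyInjective_of_injective f hinj
  have h3 : Function.Injective f.left ∧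
      ∀ x, (f.left.residueFieldMap x).hom.IsPurelyInseparable :=
    ((tfae_universallyInjective f.left).out 0 2).mp hUI
  have hPI : (f.left.residueFieldMap ξ).hom.IsPurelyInseparable := h3.2 ξ
  -- in characteristic zero the residue field map at the generic point is surjective
  have hsurjκ : Function.Surjective (f.left.residueFieldMap ξ) := by
    letI := (f.left.residueFieldMap ξ).hom.toAlgebra
    haveI : IsPurelyInseparable (Y.left.residueField (f.left ξ)) (X.left.residueField ξ) := hPI
    haveI : CharZero (Y.left.residueField (f.left ξ)) := ClosedGraph.charZero_residueField Y _
    exact IsPurelyInseparable.surjective_algebraMap_of_isSeparable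
      (Y.left.residueField (f.left ξ)) (X.left.residueField ξ)
  -- both stalks are fields (generic points of integral schemes)
  have hηY : f.left ξ = genericPoint ↥Y.left := Resolution.genericPoint_eq_of_isDominant _
  have hFY : IsField (Y.left.presheaf.stalk (f.left ξ)) := by
    rw [hηY]; exact Field.toIsField ↥Y.left.functionField
  have hFX : IsField (X.left.presheaf.stalk ξ) := Field.toIsField ↥X.left.functionField
  have hinjX : Function.Injective (X.left.residue ξ) := by
    change Function.Injective (IsLocalRing.residue _)
    rw [injective_iff_map_eq_zero]
    intro a ha
    rw [IsLocalRing.residue_eq_zero_iff, (IsLocalRing.isField_iff_maximalIdeal_eq.mp hFX)] at ha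
    exact ha
  have hsurj : Function.Surjective (f.left.stalkMap ξ) := fun b ↦ by
    obtain ⟨c, hc⟩ := hsurjκ (X.left.residue ξ b)
    obtain ⟨a, rfl⟩ := (Y.left.residue_surjective (f.left ξ)) c
    refine ⟨a, hinjX ?_⟩
    rw [← CategoryTheory.comp_apply, ← Scheme.residue_residueFieldMap, CategoryTheory.comp_apply]
    exact hc
  have hinj' : Function.Injective (f.left.stalkMap ξ) := by
    letI := hFY.toField
    exact RingHom.injective _
  exact (ConcreteCategory.isIso_iff_bijective _).mpr ⟨hinj', hsurj⟩

/-- **The relative normalisation of `Y` in `X` is `Y` itself** when `f : X ⟶ Y` is injective on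
`K`-points and dominant, `X`, `Y` integral, `Y` normal, characteristic `0`: the integral morphism
`f.fromNormalization : X′ → Y` is dominant and birational (the open immersion `X → X′` of Zariski's
Main Theorem and `isIso_stalkMap_genericPoint_of_injective`), hence an isomorphism onto the normal
`Y`. [cite: GortzWedhorn2020, Cor. 12.88] [cite: StacksProject, Tag 03GW] -/
theorem isIso_fromNormalization_of_injective [IsIntegral X.left] [IsIntegral Y.left]
    [LocallyOfFiniteType X.hom] [IsSeparated f.left] [QuasiCompact f.left] [IsDominant f.left]
    (hYn : ∀ y : Y.left, IsIntegrallyClosed (Y.left.presheaf.stalk y))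
    (hinj : Function.Injective (AlgPoints.map (L := K) f)) :
    IsIso f.left.fromNormalization := by
  haveI := locallyOfFiniteType_left f
  haveI := locallyQuasiFinite_of_injective f hinj
  -- Zariski's Main Theorem: `X ⟶ X′` is an open immersion
  haveI : IsOpenImmersion f.left.toNormalization := inferInstance
  haveI : IsIntegral f.left.normalization := inferInstance
  haveI : IsDominant f.left.fromNormalization := by
    have h : IsDominant (f.left.toNormalization ≫ f.left.fromNormalization) := by
      rw [Scheme.Hom.toNormalization_fromNormalization]; infer_instance
    exact IsDominant.of_comp f.left.toNormalization f.left.fromNormalization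
  -- the stalk map of `X′ → Y` at the generic point is an isomorphism
  haveI hst : IsIso ((f.left.toNormalization ≫ f.left.fromNormalization).stalkMap
      (genericPoint ↥X.left)) := by
    rw [Scheme.Hom.toNormalization_fromNormalization]
    exact isIso_stalkMap_genericPoint_of_injective f hinj
  have hst' : IsIso (f.left.fromNormalization.stalkMap
      (f.left.toNormalization (genericPoint ↥X.left))) :=
    IsIso.of_isIso_fac_right (f := f.left.toNormalization.stalkMap (genericPoint ↥X.left))
      (hh := hst)
      (Scheme.Hom.stalkMap_comp f.left.toNormalization f.left.fromNormalization _).symm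
  have hη : f.left.toNormalization (genericPoint ↥X.left) = genericPoint ↥f.left.normalization :=
    Resolution.genericPoint_eq_of_isDominant _
  have hstg : IsIso (f.left.fromNormalization.stalkMap (genericPoint ↥f.left.normalization)) :=
    hη ▸ hst'
  -- integral + birational onto normal ⇒ isomorphism, locally on `Y`
  have key : MorphismProperty.isomorphisms Scheme f.left.fromNormalization := by
    refine (IsZariskiLocalAtTarget.iff_of_iSup_eq_top
      (P := MorphismProperty.isomorphisms Scheme) _
      (Resolution.iSup_nonempty_affineOpens_eq_top Y.left)).mpr ?_
    rintro ⟨V, hVne⟩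
    show IsIso (f.left.fromNormalization ∣_ (V : Y.left.Opens))
    haveI := hVne
    exact Resolution.isIso_morphismRestrict_of_isIntegralHom_of_isIso_stalkMap
      f.left.fromNormalization hYn hstg V
  exact key

/-- **An injective dominant morphism of irreducible varieties onto a normal variety is an open
immersion (characteristic `0`)**: `f = (X → X′) ≫ (X′ → Y)` with the first factor an open immersion
by Zariski's Main Theorem (`f` is quasi-finite, `locallyQuasiFinite_of_injective`) and the second an
isomorphism (`isIso_fromNormalization_of_injective`). [cite: GortzWedhorn2020, Cor. 12.88]
[cite: Springer1998, Thm. 5.1.6 (iii) (p. 82)] -/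
theorem isOpenImmersion_of_injective [IsIntegral X.left] [IsIntegral Y.left]
    [LocallyOfFiniteType X.hom] [IsSeparated f.left] [QuasiCompact f.left] [IsDominant f.left]
    (hYn : ∀ y : Y.left, IsIntegrallyClosed (Y.left.presheaf.stalk y))
    (hinj : Function.Injective (AlgPoints.map (L := K) f)) : IsOpenImmersion f.left := by
  haveI := locallyOfFiniteType_left f
  haveI := locallyQuasiFinite_of_injective f hinj
  haveI := isIso_fromNormalization_of_injective f hYn hinj
  have h : IsOpenImmersion (f.left.toNormalization ≫ f.left.fromNormalization) := inferInstance
  rwa [Scheme.Hom.toNormalization_fromNormalization] at h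

/-- **Springer 5.2.8 / Borel AG.18.2, general form (no properness): a morphism of irreducible
varieties bijective on `K`-points onto a normal variety is an isomorphism, in characteristic `0`.**
Hypotheses: `K` algebraically closed of characteristic `0`; `X`, `Y` integral and locally of finite
type over `K`; `f` separated and quasi-compact; all local rings of `Y` integrally closed; `f`
bijective on `K`-points.  Proof: `f` is an open immersion (`isOpenImmersion_of_injective`) whose
open image contains every closed point of `Y`.
[cite: Springer1998, Thm. 5.2.8 (p. 85) with Thm. 5.1.6 (iii)]
[cite: Margulis1991, Ch. I (0.9) (= Borel1991, AG.18.2)] [cite: GortzWedhorn2020, Cor. 12.88]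
[cite: MumfordRedBook1999, III §9, Original form (I), pp. 209–210] -/
theorem isIso_of_bijective_of_isIntegral [IsIntegral X.left] [IsIntegral Y.left]
    [LocallyOfFiniteType X.hom] [LocallyOfFiniteType Y.hom] [IsSeparated f.left]
    [QuasiCompact f.left] (hYn : ∀ y : Y.left, IsIntegrallyClosed (Y.left.presheaf.stalk y))
    (hf : Function.Bijective (AlgPoints.map (L := K) f)) : IsIso f := by
  haveI := isDominant_of_surjective_map f hf.2
  haveI := isOpenImmersion_of_injective f hYn hf.1
  haveI : IsIso f.left := by
    rw [isIso_iff_isOpenImmersion_and_surjective]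
    exact ⟨inferInstance,
      surjective_of_isOpen_range_of_surjective_map f f.left.isOpenEmbedding.isOpen_range hf.2⟩
  haveI : IsIso ((Over.forget (Spec (CommRingCat.of K))).map f) := ‹IsIso f.left›
  exact isIso_of_reflects_iso f (Over.forget _)

/-- **A bijective morphism of irreducible varieties onto a SMOOTH variety is an isomorphism
(characteristic `0`, no properness)**: smooth over a field ⇒ normal
(`isIntegrallyClosed_stalk_of_smooth`). [cite: Springer1998, Thm. 5.2.8 (p. 85)]
[cite: Margulis1991, Ch. I (0.9) (= Borel1991, AG.18.2)] -/
theorem isIso_of_bijective_of_isIntegral_of_smooth [IsIntegral X.left] [IsIntegral Y.left]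
    [LocallyOfFiniteType X.hom] [Smooth Y.hom] [IsSeparated f.left] [QuasiCompact f.left]
    (hf : Function.Bijective (AlgPoints.map (L := K) f)) : IsIso f :=
  isIso_of_bijective_of_isIntegral f (isIntegrallyClosed_stalk_of_smooth Y) hf

/-- **Relative form: a PROPER morphism, bijective on `K`-points, from a reduced `K`-scheme locally
of finite type onto an integral normal `K`-scheme locally of finite type is an isomorphism**
(`K = K̄` of characteristic `0`).  No properness of `X` or `Y` themselves is assumed — the form
needed to recognise a proper comparison map between NON-proper varieties (e.g. a level transition
of a Shimura tower modulo a finite group) as an isomorphism.  Proof: `X` is irreducible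
(`irreducibleSpace_of_bijective_of_isProper`), hence integral; apply
`isIso_of_bijective_of_isIntegral`. [cite: Springer1998, Thm. 5.2.8 (p. 85) with Thm. 5.1.6 (iii)]
[cite: GortzWedhorn2020, Cor. 12.88] [cite: MumfordRedBook1999, III §9, Original form (I)] -/
theorem isIso_of_bijective_of_isProper [IsReduced X.left] [IsIntegral Y.left]
    [LocallyOfFiniteType X.hom] [LocallyOfFiniteType Y.hom] [IsProper f.left]
    (hYn : ∀ y : Y.left, IsIntegrallyClosed (Y.left.presheaf.stalk y))
    (hf : Function.Bijective (AlgPoints.map (L := K) f)) : IsIso f := by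
  haveI := irreducibleSpace_of_bijective_of_isProper f hf
  haveI : IsIntegral X.left := isIntegral_of_irreducibleSpace_of_isReduced X.left
  exact isIso_of_bijective_of_isIntegral f hYn hf

/-- **Relative form, smooth target**: a proper morphism bijective on `K`-points from a reduced
`K`-scheme onto an integral SMOOTH `K`-scheme (both locally of finite type, `K = K̄` of
characteristic `0`) is an isomorphism. [cite: Springer1998, Thm. 5.2.8 (p. 85)]
[cite: Margulis1991, Ch. I (0.9) (= Borel1991, AG.18.2)] -/
theorem isIso_of_bijective_of_isProper_of_smooth [IsReduced X.left] [IsIntegral Y.left]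
    [LocallyOfFiniteType X.hom] [Smooth Y.hom] [IsProper f.left]
    (hf : Function.Bijective (AlgPoints.map (L := K) f)) : IsIso f :=
  isIso_of_bijective_of_isProper f (isIntegrallyClosed_stalk_of_smooth Y) hf

end CharZero

end Literature.AlgebraicGeometry.Motives

end
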